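import Summits.QuantumAdvantage.QuantumAdvantage.Theorems.WalkNoPerfectKFormCore
import Summits.QuantumAdvantage.QuantumAdvantage.Theorems.WalkNoPerfectLinSel
import HarnessLib

/-!
# No perfect `k`-form strategy for the u-walk game, `p ≥ 5` — in particular `NoPerfectFinState2 p n₀` for EVERY prime `p ≥ 5`
(planner qa-qnc0-p2 g23, ROUND-23 §6; part 3b; the expansion is in part 3a `WalkNoPerfectKFormCore`)

**Theorem A′ (`noPerfectKForm`).** Fix a prime `p ≥ 5` and `k : ℕ`.  For all large `n`, every charge `c` and every strategy in which
cut `g`'s decision is an ARBITRARY function `F g` of `k` linear forms `Σ_i λ_{g,j,i} u_i (mod p)` (`j < k`), some input `u` loses the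
u-walk game.  Explicitly it suffices that `(n+1)·2p^k·(2p−1)ⁿ < (2p)ⁿ`; for `k = 1` this is Theorem A (`LinSel`, single-residue tests) and
the multi-residue / set-membership tests; `k = 2` contains the finite-state class `FinState2` (tables of `(wtPrefix mod p, wt mod p)`), so

**Corollary (`noPerfectFinState2_allPrimes`).** `∃ n₀, NoPerfectFinState2 p n₀` for every prime `p ≥ 5` (ROUND-21 §6 (H) was `p = 5`,
sharp `n₀ = 12`, by certified computation; and `p = 5` via rung (G)).  Per-cut rank up to `k ≈ n /((2p−1) ln p)` is covered; rank `n`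
(= arbitrary Boolean functions) plays perfectly, so some rank restriction is necessary.

Method: as in parts 1–2, with the Fourier expansion on `(ZMod p)^k`: `[F_g(x) = 1] = Σ_a F̂_g(a) ω^{a·x}`,
`F̂_g(a) = Σ_v [F_g v] ω^{−a·v}` (orthogonality, `(p : K) = 1`), and `ω^{a·x(u)} = ∏_i (ω^{Σ_j a_j λ_{g,j,i}})^{u_i}`: the fire count is a
`2p^k(n+1)`-term sum of cube characters whose coordinates are again of the form `ω^x ζ^y`, `y ∈ {1,2}`; the killing functional and the
double count are those of part 1, packaged here once for an arbitrary finite term type (`generic_kill`).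
-/

open Finset

namespace Summit.QuantumAdvantage.AdviceFreeQNC0

namespace Coset21

namespace CharTwoKill

/-! ### §14 The numerical threshold with an arbitrary constant: `(n+1)·A·(q−1)ⁿ < qⁿ` eventually -/

/-- the numerical threshold with a constant: `(n+1)·A·(q−1)ⁿ < qⁿ` for all large `n` (`q ≥ 2`) -/
theorem count_eventually' (A q : ℕ) (hq : 2 ≤ q) :
    ∃ n₀, ∀ n ≥ n₀, (n + 1) * A * (q - 1) ^ n < q ^ n := by
  have hq0 : (0 : ℝ) < q := by exact_mod_cast (by omega : 0 < q)
  have hA0 : (0 : ℝ) ≤ A := by exact_mod_cast (Nat.zero_le A)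
  set ρ : ℝ := ((q : ℝ) - 1) / q with hρ
  have hq2 : (2 : ℝ) ≤ q := by exact_mod_cast hq
  have hρ0 : 0 ≤ ρ := div_nonneg (by linarith) hq0.le
  have hρ1 : ρ < 1 := by rw [div_lt_one hq0]; linarith
  have ht := tendsto_self_mul_const_pow_of_lt_one hρ0 hρ1
  have hε : (0 : ℝ) < 1 / (4 * A + 4) := by positivity
  obtain ⟨N, hN⟩ := Filter.eventually_atTop.mp (ht.eventually (gt_mem_nhds hε))
  refine ⟨max N 1, fun n hn => ?_⟩
  have hnN : N ≤ n := le_trans (le_max_left _ _) hn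
  have hn1 : 1 ≤ n := le_trans (le_max_right _ _) hn
  have h1 : (n : ℝ) * ρ ^ n < 1 / (4 * A + 4) := hN n hnN
  have hqn : (0 : ℝ) < (q : ℝ) ^ n := pow_pos hq0 n
  have hn1' : (1 : ℝ) ≤ n := by exact_mod_cast hn1
  have hsmall : ((n : ℝ) + 1) * A * ρ ^ n < 1 := by
    have hρn0 : (0 : ℝ) ≤ A * ρ ^ n := by positivity
    calc ((n : ℝ) + 1) * A * ρ ^ n ≤ 2 * n * A * ρ ^ n := by nlinarith
      _ = 2 * A * (n * ρ ^ n) := by ring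
      _ ≤ 2 * A * (1 / (4 * A + 4)) := by apply mul_le_mul_of_nonneg_left h1.le; positivity
      _ < 1 := by rw [mul_one_div, div_lt_one (by positivity)]; linarith
  have key : ((n : ℝ) + 1) * A * ((q : ℝ) - 1) ^ n < (q : ℝ) ^ n := by
    have hρn : ((q : ℝ) - 1) ^ n = ρ ^ n * (q : ℝ) ^ n := by
      rw [hρ, div_pow, div_mul_cancel₀ _ hqn.ne']
    rw [hρn]
    calc ((n : ℝ) + 1) * A * (ρ ^ n * (q : ℝ) ^ n) = (((n : ℝ) + 1) * A * ρ ^ n) * (q : ℝ) ^ n := by ring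
      _ < 1 * (q : ℝ) ^ n := mul_lt_mul_of_pos_right hsmall hqn
      _ = (q : ℝ) ^ n := one_mul _
  have hcast : (((n + 1) * A * (q - 1) ^ n : ℕ) : ℝ) = ((n : ℝ) + 1) * A * ((q : ℝ) - 1) ^ n := by
    push_cast [Nat.cast_sub (by omega : 1 ≤ q)]
    ring
  have : (((n + 1) * A * (q - 1) ^ n : ℕ) : ℝ) < ((q ^ n : ℕ) : ℝ) := by
    rw [hcast]; push_cast; exact key
  exact_mod_cast this

/-! ### §15 The walk game: `k`-form strategies and the finite-state class `FinState2` -/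

section WalkK

variable {p : ℕ} [Fact p.Prime] {K : Type*} [Field K] [CharP K 2]

/-- the fire set of the walk game under a `k`-form strategy is the abstract `k`-form fire set -/
theorem walkK_filter_eq {n k : ℕ} (c : ℕ) (y : Fin (n + 1) → (Fin n → Bool) → Bool)
    (lam : Fin (n + 1) → Fin k → Fin n → ZMod p) (F : Fin (n + 1) → (Fin k → ZMod p) → Bool)
    (hy : ∀ g u, y g u = F g (fun j => ∑ i, if u i = true then lam g j i else 0)) (u : Fin n → Bool) :
    (univ.filter fun g : Fin (n + 1) => y g u = true ∧ (c + g.val + walkExp u g.val) % 3 ≠ 0)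
      = (univ.filter fun g : Fin (n + 1) =>
          F g (kForm lam g u) = true ∧ ((c + g.val) + wForm (fun g' i => ww g'.val i) g u) % 3 ≠ 0) := by
  refine filter_congr fun g _ => ?_
  rw [hy g u, walkExp_eq_sum]
  unfold kForm wForm
  simp only [add_assoc]

/-- **Theorem A′ over any field of characteristic two with the two roots of unity.** -/
theorem noPerfectKForm_of_roots (ω ζ : K) (hω : IsPrimitiveRoot ω p) (hζ : IsPrimitiveRoot ζ 3) (hp5 : 5 ≤ p)
    (k : ℕ) : ∃ n₀ : ℕ, ∀ n ≥ n₀, ∀ c : ℕ, ∀ lam : Fin (n + 1) → Fin k → Fin n → ZMod p,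
      ∀ F : Fin (n + 1) → (Fin k → ZMod p) → Bool, ∀ y : Fin (n + 1) → (Fin n → Bool) → Bool,
        (∀ g u, y g u = F g (fun j => ∑ i, if u i = true then lam g j i else 0)) → ∃ u, ringWinU c y u = false := by
  classical
  obtain ⟨n₀, hn₀⟩ := count_eventually' (p ^ k * 2) (2 * p) (by omega)
  refine ⟨n₀, fun n hn c lam F y hy => ?_⟩
  have hcount : Fintype.card (Fin (n + 1)) * (p ^ k * 2) * (2 * p - 1) ^ n < (2 * p) ^ n := by
    rw [Fintype.card_fin]; exact hn₀ n hn
  obtain ⟨u, hu⟩ := abstract_even_existsK ω ζ hω lam F (fun g : Fin (n + 1) => c + g.val)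
    (fun (g : Fin (n + 1)) (i : Fin n) => ww g.val i) hp5 hζ (fun g i => ww_mem g.val i) hcount
  refine ⟨u, ?_⟩
  rw [Bool.eq_false_iff]
  intro hwin
  simp only [ringWinU, decide_eq_true_eq] at hwin
  rw [walkK_filter_eq c y lam F hy u] at hwin
  omega

/-- `wtPrefix` and `wt`, cast into `ZMod p`, are the two linear forms `Σ_{i<g} u_i` and `Σ_i u_i`. -/
theorem wtPrefix_cast_eq {n : ℕ} (u : Fin n → Bool) (g : ℕ) :
    ((wtPrefix u g : ℕ) : ZMod p) = ∑ i : Fin n, if u i = true then (if i.val < g then (1 : ZMod p) else 0) else 0 := by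
  unfold wtPrefix
  rw [natCast_card_filter]
  refine sum_congr rfl fun i _ => ?_
  by_cases h1 : i.val < g <;> by_cases h2 : u i = true <;> simp [h1, h2]

/-- `wt`, cast into `ZMod p`, is the all-ones form -/
theorem wt_cast_eq {n : ℕ} (u : Fin n → Bool) :
    ((wt u : ℕ) : ZMod p) = ∑ i : Fin n, if u i = true then (1 : ZMod p) else 0 := by
  unfold wt
  rw [natCast_card_filter]

/-- **Corollary over the abstract field:** `FinState2` strategies are `2`-form strategies, hence never perfect for large `n`. -/
theorem noPerfectFinState2_of_roots (ω ζ : K) (hω : IsPrimitiveRoot ω p) (hζ : IsPrimitiveRoot ζ 3) (hp5 : 5 ≤ p) :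
    ∃ n₀, NoPerfectFinState2 p n₀ := by
  classical
  obtain ⟨n₀, hn₀⟩ := noPerfectKForm_of_roots ω ζ hω hζ hp5 2
  refine ⟨n₀, fun n hn c y hy => ?_⟩
  obtain ⟨T, hT⟩ := hy
  -- form 0 = prefix count, form 1 = total count
  let lam : Fin (n + 1) → Fin 2 → Fin n → ZMod p :=
    fun g j i => if j = 0 then (if i.val < g.val then 1 else 0) else 1
  let F : Fin (n + 1) → (Fin 2 → ZMod p) → Bool := fun g v => T g (v 0) (v 1)
  refine hn₀ n hn c lam F y fun g u => ?_
  rw [hT g u]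
  show T g _ _ = T g _ _
  congr 1
  · rw [wtPrefix_cast_eq]
    refine sum_congr rfl fun i _ => ?_
    simp [lam]
  · rw [wt_cast_eq]
    refine sum_congr rfl fun i _ => ?_
    simp [lam]

end WalkK

end CharTwoKill

/-! ### §16 Instantiation -/

section InstantiateK

variable (p : ℕ) [Fact p.Prime]

/-- **Theorem A′ (`k`-form strategies) for every prime `p ≥ 5`.**  If cut `g` decides by an arbitrary table `F g` of `k` linear forms
`mod p` of the input, the strategy loses on some input once `n ≥ n₀(p,k)`. -/
theorem noPerfectKForm (hp5 : 5 ≤ p) (k : ℕ) :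
    ∃ n₀ : ℕ, ∀ n ≥ n₀, ∀ c : ℕ, ∀ lam : Fin (n + 1) → Fin k → Fin n → ZMod p,
      ∀ F : Fin (n + 1) → (Fin k → ZMod p) → Bool, ∀ y : Fin (n + 1) → (Fin n → Bool) → Bool,
        (∀ g u, y g u = F g (fun j => ∑ i, if u i = true then lam g j i else 0)) → ∃ u, ringWinU c y u = false := by
  obtain ⟨hK, ω, ζ, hω, hζ⟩ := exists_charTwo_roots p hp5
  exact CharTwoKill.noPerfectKForm_of_roots ω ζ hω hζ hp5 k

/-- **`NoPerfectFinState2 p n₀` for EVERY prime `p ≥ 5`** (ROUND-21 §6 (H), typed in `Theorems/WalkFiniteState.lean`; previously known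
for `p = 5` only: sharp `n₀ = 12` by certified computation, and via rung (G)). -/
theorem noPerfectFinState2_allPrimes (hp5 : 5 ≤ p) : ∃ n₀, NoPerfectFinState2 p n₀ := by
  obtain ⟨hK, ω, ζ, hω, hζ⟩ := exists_charTwo_roots p hp5
  exact CharTwoKill.noPerfectFinState2_of_roots ω ζ hω hζ hp5

/-- Item form (candidate support statement `OddPrimeWalk.NoPerfectFinState2Odd`, signature verbatim). -/
theorem noPerfectFinState2Odd : ∀ (p : ℕ) [Fact p.Prime], 5 ≤ p → ∃ n₀, NoPerfectFinState2 p n₀ :=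
  fun p _ hp => noPerfectFinState2_allPrimes p hp

/-- Item form of Theorem A′ (candidate support statement `OddPrimeWalk.NoPerfectKFormOdd`, signature verbatim): for every prime `p ≥ 5`
and every `k`, for large `n` no strategy whose cuts decide by tables of `k` linear forms `mod p` wins the u-walk game on every input. -/
theorem noPerfectKFormOdd : ∀ (p : ℕ) [Fact p.Prime], 5 ≤ p → ∀ k : ℕ, ∃ n₀ : ℕ, ∀ n ≥ n₀, ∀ c : ℕ,
    ∀ lam : Fin (n + 1) → Fin k → Fin n → ZMod p, ∀ F : Fin (n + 1) → (Fin k → ZMod p) → Bool,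
    ∀ y : Fin (n + 1) → (Fin n → Bool) → Bool,
      (∀ g u, y g u = F g (fun j => Finset.univ.sum fun i => if u i = true then lam g j i else 0)) →
        ∃ u, ringWinU c y u = false :=
  fun p _ hp k => noPerfectKForm p hp k

end InstantiateK

end Coset21

end Summit.QuantumAdvantage.AdviceFreeQNC0
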